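import Literature.Probability.Percolation.OneArmSubsequentialLimits
import Literature.Probability.Percolation.OneArmArcCouplingLimit
import HarnessLib

/-!
# The discrete arc hulls `Q_δ(θ)` of Lawler–Schramm–Werner and their joint laws with `Q_δ(2π)`

Topic `Literature/Probability/Percolation`; family `crit-perc` (critical site percolation on the
triangular lattice `𝕋`). Lawler–Schramm–Werner, *One-arm exponent for critical 2D percolation*,
Electron. J. Probab. **7** (2002), paper no. 2, §2 (p. 3):

> "Let `θ ∈ [0, 2π]`, and let `A_θ` be the arc `A_θ := {e^{is} : s ∈ [0, θ]} ⊂ ∂𝕌`. […] let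
> `Q_δ(θ)` denote the union of `A_θ` with all the connected components of `𝔅_δ ∩ Ū` which meet
> `A_θ`."

The tree renders `Q_δ(2π)` at mesh `δ = 1/R` as `lswCompact R ω = ∂𝕌 ∪ R⁻¹ · lswSites R ω`
(`OneArmScalingLimit.lean`: the sites `‖x‖ < R` joined by an open path of `𝕋` to an open site of
norm `> R`, i.e. — by first exit from the disc `‖·‖ ≤ R` — the open clusters of the disc having an
open neighbour outside it). This file adds the arc version, with the same discretisation of
"meeting the boundary" (an open edge across the circle `C_R`), the arc being met when the outer
endpoint of that edge points in a direction of the arc: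

* `bottomArcPt s = e^{i(s - π/2)}`, `bottomArc θ = {e^{i(s - π/2)} : s ∈ [0, θ]}` — LSW's arc
  `A_θ` ROTATED by `-π/2`, i.e. anchored at the bottom point `-i` of the circle instead of `1`
  (for `θ < 0` the arc is `{-i}`). The rotation is immaterial in the continuum (the laws of the
  scaling limit are rotation invariant, and the tail estimate consumed downstream,
  `renewal_hypotheses_of_arcCoupling_linear`, is localised at an arbitrary boundary point `ζ`),
  but not on the lattice: at `∓i` the tangent to the circle is a lattice line of `𝕋` (direction
  `e₀`), so that the clusters of the disc near the anchor live in a translate of the lattice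
  half-plane `upperHalfPlane` of `HalfPlaneArmEvents.lean`, where the half-plane arm estimates of
  the tree (`Nolin2008_halfPlane_twoArm_holds`) are available; at `1` the tangent is a dual
  direction. `InBottomArcDir θ z`: `z = |z| e^{i(s - π/2)}` for some `s ∈ [0, θ]`.
* `lswArcSites R θ ω` — the sites `‖x‖ < R` joined inside the disc `‖·‖ ≤ R` by open sites to an
  open edge `a ∼ b`, `‖a‖ ≤ R < ‖b‖`, whose outer endpoint `b` points in a direction of the arc;
  `lswArcSet R θ ω = bottomArc θ ∪ R⁻¹ · lswArcSites R θ ω` and the random non-empty compact set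
  `lswArcCompact R θ ω` (`Q_δ(θ)`, `δ = 1/R`); the pair `lswArcPair R θ ω = (Q_δ(θ), Q_δ(2π))` and
  its law `lswPairLaw R θ` on `NonemptyCompacts ℂ × NonemptyCompacts ℂ`.
* Proved API: `bottomArc ⊆ ∂𝔻`, `-i ∈ bottomArc θ`, monotonicity in `θ`, every direction is an
  arc direction for `θ ≥ 2π` (`inBottomArcDir_of_two_pi_le`) and hence **`Q_δ(θ) = Q_δ(2π)` of the
  tree for `θ ≥ 2π`** (`lswArcSites_eq_lswSites`, `lswArcSet_eq_lswSet`: faithfulness of the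
  rendering); **`Q_δ(θ) ⊆ Q_δ(2π)`** (`lswArcSet_subset_lswSet`); locality (`lswArcSites_inter_eq`:
  only sites of norm `≤ R + 1` matter), measurability (`measurable_lswArcCompact`,
  `measurable_lswArcPair`), the second marginal **`(lswPairLaw R θ).map snd = lswLaw R`**
  (`map_snd_lswPairLaw`), the inclusion a.s. (`ae_fst_subset_snd_lswPairLaw`), and that the pair
  laws are carried by `subUnitDisc ×ˢ subUnitDisc` (`lswPairLaw_compl_prod_subUnitDisc`, the
  hypothesis of `exists_tendsto_subseq_pairLaw` of `OneArmNeumannCoupling.lean`); the gap geometry: a direction which is not an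
  arc direction, and a point of the circle off the arc, lie within `2π - θ` of the anchor
  (`norm_sub_norm_mul_neg_I_le_of_not_inBottomArcDir`, `norm_sub_neg_I_le_of_mem_sphere_diff`).

These are the couplings of `(Q_δ(θ), Q_δ(2π))` whose subsequential weak limits
(`exists_tendsto_subseq_pairLaw`, `arcCoupling_of_tendsto`) feed `renewal_hypotheses_of_arcCoupling_linear`
(`OneArmNeumannCouplingLinear.lean`); the tail estimate (2.14) for them is the subject of the
sequel `OneArmArcTail.lean`. No named facts.

## References

* G. F. Lawler, O. Schramm, W. Werner, *One-arm exponent for critical 2D percolation*, Electron.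
  J. Probab. 7 (2002), no. 2, §2 (p. 3: `A_θ`, `Q_δ(θ)`; p. 6: `Q' = Q(2π) ∖ Q(θ)`)
  [LawlerSchrammWernerEJP2002].

## Mathlib / tree

Tree: `lswSites`, `lswSet`, `lswCompact`, `lswLaw`, `triSiteLawHalf`, `measurable_lswCompact`,
`lswSet_subset_closedBall`, `subUnitDisc` (`OneArmScalingLimit`, `OneArmSubsequentialLimits`),
`isClosed_setOf_fst_subset_snd` (`OneArmArcCouplingLimit`),
`PathIn.exit`, `norm_triEmbed_le_of_adj`, `subset_box_of_norm_le`,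
`DeterminedBy.measurableSet_of_finset`. Mathlib: `Complex.norm_mul_exp_arg_mul_I`,
`Complex.exp_two_pi_mul_I`, `Real.norm_exp_I_mul_ofReal_sub_one_le`, `Complex.norm_exp_ofReal_mul_I`.
-/

noncomputable section

open MeasureTheory Filter Topology Set Metric TopologicalSpace Complex
open Literature.Probability.LatticeModels

namespace Literature.Probability.Percolation

/-! ### The arc anchored at the bottom point `-i` -/

/-- The point `e^{i(s - π/2)}` of the unit circle: the arc `A_θ` of LSW rotated by `-π/2`, so that
`s = 0` is the bottom point `-i`. [cite: LawlerSchrammWernerEJP2002, §2 (p. 3)] -/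
def bottomArcPt (s : ℝ) : ℂ := exp (((s - Real.pi / 2 : ℝ) : ℂ) * I)

/-- **The arc `A_θ^↓ = {e^{i(s - π/2)} : 0 ≤ s ≤ θ}`** (LSW's `A_θ = {e^{is} : s ∈ [0, θ]}` rotated
by `-π/2`; for `θ < 0` the singleton `{-i}`). [cite: LawlerSchrammWernerEJP2002, §2 (p. 3)] -/
def bottomArc (θ : ℝ) : Set ℂ := bottomArcPt '' Icc 0 (max θ 0)

/-- `z` points in a direction of the arc `A_θ^↓`: `z = |z| e^{i(s - π/2)}` for some
`s ∈ [0, max θ 0]`. [cite: LawlerSchrammWernerEJP2002, §2 (p. 3)] -/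
def InBottomArcDir (θ : ℝ) (z : ℂ) : Prop := ∃ s ∈ Icc 0 (max θ 0), z = (‖z‖ : ℂ) * bottomArcPt s

/-- `bottomArcPt` unfolded. [folklore] -/
theorem bottomArcPt_apply (s : ℝ) : bottomArcPt s = exp (((s - Real.pi / 2 : ℝ) : ℂ) * I) := rfl

/-- `|e^{i(s - π/2)}| = 1`. [folklore] -/
@[simp] theorem norm_bottomArcPt (s : ℝ) : ‖bottomArcPt s‖ = 1 := norm_exp_ofReal_mul_I _

/-- `bottomArcPt 0 = -i`. [folklore] -/
theorem bottomArcPt_zero : bottomArcPt 0 = -I := by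
  rw [bottomArcPt_apply, zero_sub, show (((-(Real.pi / 2) : ℝ)) : ℂ) * I = -(Real.pi / 2 * I) by
    push_cast; ring, Complex.exp_neg, exp_pi_div_two_mul_I, inv_I]

/-- `s ↦ e^{i(s - π/2)}` is continuous. [folklore] -/
theorem continuous_bottomArcPt : Continuous bottomArcPt :=
  Complex.continuous_exp.comp ((Complex.continuous_ofReal.comp (continuous_id.sub continuous_const)).mul
    continuous_const)

/-- The chord is at most the arc: `|e^{i(s - π/2)} - e^{i(s' - π/2)}| ≤ |s - s'|`. [folklore] -/
theorem norm_bottomArcPt_sub_le (s s' : ℝ) : ‖bottomArcPt s - bottomArcPt s'‖ ≤ |s - s'| := by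
  have hfac : bottomArcPt s - bottomArcPt s' = bottomArcPt s' * (exp (I * ((s - s' : ℝ) : ℂ)) - 1) := by
    rw [mul_sub, mul_one, bottomArcPt_apply, bottomArcPt_apply, ← Complex.exp_add]
    congr 2
    push_cast
    ring
  rw [hfac, norm_mul, norm_bottomArcPt, one_mul]
  exact (Real.norm_exp_I_mul_ofReal_sub_one_le (x := s - s')).trans (le_of_eq (Real.norm_eq_abs _))

/-- Adding `2π` to the parameter does not change the point. [folklore] -/
theorem bottomArcPt_add_two_pi (s : ℝ) : bottomArcPt (s + 2 * Real.pi) = bottomArcPt s := by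
  rw [bottomArcPt_apply, bottomArcPt_apply, show (((s + 2 * Real.pi - Real.pi / 2 : ℝ)) : ℂ) * I =
    ((s - Real.pi / 2 : ℝ) : ℂ) * I + 2 * Real.pi * I by push_cast; ring, Complex.exp_add,
    exp_two_pi_mul_I, mul_one]

/-- **Every direction has a parameter in `[0, 2π)`**: `z = |z| e^{i(s - π/2)}` with `0 ≤ s < 2π`
(`s ≡ arg z + π/2`). [folklore] -/
theorem exists_eq_norm_mul_bottomArcPt (z : ℂ) : ∃ s ∈ Ico 0 (2 * Real.pi), z = (‖z‖ : ℂ) * bottomArcPt s := by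
  have hkey : ∀ s : ℝ, bottomArcPt s = exp (arg z * I) → z = (‖z‖ : ℂ) * bottomArcPt s := fun s hs ↦ by
    rw [hs, norm_mul_exp_arg_mul_I]
  have h1 : bottomArcPt (arg z + Real.pi / 2) = exp (arg z * I) := by
    rw [bottomArcPt_apply]; congr 1; push_cast; ring
  have hargle := arg_le_pi z
  have harggt := neg_pi_lt_arg z
  by_cases h : 0 ≤ arg z + Real.pi / 2
  · exact ⟨arg z + Real.pi / 2, ⟨h, by linarith [Real.pi_pos]⟩, hkey _ h1⟩
  · push Not at h
    refine ⟨arg z + Real.pi / 2 + 2 * Real.pi, ⟨by linarith [Real.pi_pos], by linarith⟩, hkey _ ?_⟩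
    rw [bottomArcPt_add_two_pi, h1]

/-- The arc lies on the unit circle. [cite: LawlerSchrammWernerEJP2002, §2 (p. 3)] -/
theorem bottomArc_subset_sphere (θ : ℝ) : bottomArc θ ⊆ sphere (0 : ℂ) 1 := by
  rintro _ ⟨s, -, rfl⟩
  simp

/-- The anchor `-i` lies on every arc. [folklore] -/
theorem neg_I_mem_bottomArc (θ : ℝ) : -I ∈ bottomArc θ :=
  ⟨0, ⟨le_rfl, le_max_right _ _⟩, bottomArcPt_zero⟩

/-- The arc is compact. [folklore] -/
theorem isCompact_bottomArc (θ : ℝ) : IsCompact (bottomArc θ) :=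
  isCompact_Icc.image continuous_bottomArcPt

/-- The arcs increase with `θ`. [folklore] -/
theorem bottomArc_mono {θ θ' : ℝ} (h : θ ≤ θ') : bottomArc θ ⊆ bottomArc θ' :=
  image_mono (Icc_subset_Icc le_rfl (max_le_max h le_rfl))

/-- Arc directions increase with `θ`. [folklore] -/
theorem InBottomArcDir.mono {θ θ' : ℝ} (h : θ ≤ θ') {z : ℂ} (hz : InBottomArcDir θ z) :
    InBottomArcDir θ' z := by
  obtain ⟨s, hs, hzs⟩ := hz
  exact ⟨s, ⟨hs.1, hs.2.trans (max_le_max h le_rfl)⟩, hzs⟩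

/-- **For `θ ≥ 2π` every direction is an arc direction** (the arc is the whole circle).
[cite: LawlerSchrammWernerEJP2002, §2 (p. 3)] -/
theorem inBottomArcDir_of_two_pi_le {θ : ℝ} (hθ : 2 * Real.pi ≤ θ) (z : ℂ) : InBottomArcDir θ z := by
  obtain ⟨s, hs, hzs⟩ := exists_eq_norm_mul_bottomArcPt z
  exact ⟨s, ⟨hs.1, hs.2.le.trans (hθ.trans (le_max_left _ _))⟩, hzs⟩

/-- For `θ ≥ 2π` the arc is the whole unit circle. [cite: LawlerSchrammWernerEJP2002, §2 (p. 3)] -/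
theorem bottomArc_eq_sphere {θ : ℝ} (hθ : 2 * Real.pi ≤ θ) : bottomArc θ = sphere (0 : ℂ) 1 := by
  refine Subset.antisymm (bottomArc_subset_sphere θ) fun p hp ↦ ?_
  obtain ⟨s, hs, hps⟩ := inBottomArcDir_of_two_pi_le hθ p
  have hn : ‖p‖ = 1 := by simpa using hp
  rw [hn, Complex.ofReal_one, one_mul] at hps
  exact ⟨s, hs, hps.symm⟩

/-- **The gap is short**: if the direction of `z` is not an arc direction of `A_θ^↓`, then
`z = |z| e^{i(s - π/2)}` with `θ < s < 2π` (the parameter of `z` in `[0, 2π)` is not `≤ θ`). [cite: LawlerSchrammWernerEJP2002, §2 (p. 6, Q' near the endpoint of the arc)] -/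
theorem exists_mem_Ioo_of_not_inBottomArcDir {θ : ℝ} {z : ℂ} (hz : ¬ InBottomArcDir θ z) :
    ∃ s ∈ Ioo θ (2 * Real.pi), z = (‖z‖ : ℂ) * bottomArcPt s := by
  obtain ⟨s, hs, hzs⟩ := exists_eq_norm_mul_bottomArcPt z
  refine ⟨s, ⟨?_, hs.2⟩, hzs⟩
  by_contra hle
  push Not at hle
  exact hz ⟨s, ⟨hs.1, hle.trans (le_max_left _ _)⟩, hzs⟩

/-- **A non-arc direction is close to the anchor direction**: if the direction of `z` is not an
arc direction of `A_θ^↓` then `‖z - |z| (-i)‖ ≤ (2π - θ) |z|` (chord at most arc). [cite: LawlerSchrammWernerEJP2002, §2 (p. 6)] -/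
theorem norm_sub_norm_mul_neg_I_le_of_not_inBottomArcDir {θ : ℝ} {z : ℂ}
    (hz : ¬ InBottomArcDir θ z) : ‖z - (‖z‖ : ℂ) * (-I)‖ ≤ (2 * Real.pi - θ) * ‖z‖ := by
  obtain ⟨s, hs, hzs⟩ := exists_mem_Ioo_of_not_inBottomArcDir hz
  have h1 : z - (‖z‖ : ℂ) * (-I) = (‖z‖ : ℂ) * (bottomArcPt s - bottomArcPt (2 * Real.pi)) := by
    rw [show (2 * Real.pi : ℝ) = 0 + 2 * Real.pi by ring, bottomArcPt_add_two_pi, bottomArcPt_zero,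
      mul_sub, ← hzs]
  rw [h1, norm_mul, Complex.norm_real, Real.norm_of_nonneg (norm_nonneg _), mul_comm]
  refine mul_le_mul_of_nonneg_right ((norm_bottomArcPt_sub_le s (2 * Real.pi)).trans ?_) (norm_nonneg _)
  rw [abs_sub_comm, abs_of_nonneg (by linarith [hs.2])]
  linarith [hs.1]

/-- **A point of the circle off the arc is within `2π - θ` of the anchor**: the circle minus
`A_θ^↓` is the open arc of length `2π - θ` ending at `-i`. [cite: LawlerSchrammWernerEJP2002, §2 (p. 6)] -/
theorem norm_sub_neg_I_le_of_mem_sphere_diff {θ : ℝ} {p : ℂ}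
    (hp : p ∈ sphere (0 : ℂ) 1 \ bottomArc θ) : ‖p - (-I)‖ ≤ 2 * Real.pi - θ := by
  have hn : ‖p‖ = 1 := by simpa using hp.1
  have hdir : ¬ InBottomArcDir θ p := by
    rintro ⟨s, hs, hps⟩
    rw [hn, Complex.ofReal_one, one_mul] at hps
    exact hp.2 ⟨s, hs, hps.symm⟩
  have := norm_sub_norm_mul_neg_I_le_of_not_inBottomArcDir hdir
  rwa [hn, Complex.ofReal_one, one_mul, mul_one] at this

/-! ### The discrete arc hulls `Q_δ(θ)`, `δ = 1/R` -/

/-- The sites of `Q_δ(θ)` at mesh `δ = 1/R` before rescaling: the sites `x` of `𝕋` with `‖x‖ < R`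
joined inside the disc `‖·‖ ≤ R` by open sites to an open edge `a ∼ b` across the circle
(`‖a‖ ≤ R < ‖b‖`, `b` open) whose outer endpoint points in a direction of the arc `A_θ^↓` — the
open clusters of the disc "meeting the arc" (LSW 2002, §2, p. 3; discretisation as in `lswSites`,
which is the case `θ = 2π`, `lswArcSites_eq_lswSites`). [cite: LawlerSchrammWernerEJP2002, §2 (p. 3)] -/
def lswArcSites (R θ : ℝ) (ω : SiteConfig (Site 2)) : Set (Site 2) :=
  {x | ‖triEmbed x‖ < R ∧ ∃ a b : Site 2, PathIn triGraph ({v | ‖triEmbed v‖ ≤ R} ∩ ω) x a ∧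
    triGraph.Adj a b ∧ b ∈ ω ∧ R < ‖triEmbed b‖ ∧ InBottomArcDir θ (triEmbed b)}

/-- Membership in `lswArcSites`, unfolded. [folklore] -/
theorem mem_lswArcSites_iff {R θ : ℝ} {ω : SiteConfig (Site 2)} {x : Site 2} :
    x ∈ lswArcSites R θ ω ↔ ‖triEmbed x‖ < R ∧ ∃ a b : Site 2,
      PathIn triGraph ({v | ‖triEmbed v‖ ≤ R} ∩ ω) x a ∧ triGraph.Adj a b ∧ b ∈ ω ∧
        R < ‖triEmbed b‖ ∧ InBottomArcDir θ (triEmbed b) :=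
  Iff.rfl

/-- **`Q_δ(θ) ⊆ Q_δ(2π)` on sites**: an arc site is a site of `lswSites` (extend the path inside the
disc by the edge across the circle). [cite: LawlerSchrammWernerEJP2002, §2 (p. 6: Q(θ) ⊆ Q(2π))] -/
theorem lswArcSites_subset_lswSites (R θ : ℝ) (ω : SiteConfig (Site 2)) :
    lswArcSites R θ ω ⊆ lswSites R ω := by
  rintro x ⟨hx, a, b, hp, hab, hb, hRb, -⟩
  exact ⟨hx, b, hRb, (hp.mono inter_subset_right).tail hab hb⟩

/-- The arc sites increase with `θ`. [folklore] -/
theorem lswArcSites_mono {R θ θ' : ℝ} (h : θ ≤ θ') (ω : SiteConfig (Site 2)) :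
    lswArcSites R θ ω ⊆ lswArcSites R θ' ω := by
  rintro x ⟨hx, a, b, hp, hab, hb, hRb, hdir⟩
  exact ⟨hx, a, b, hp, hab, hb, hRb, hdir.mono h⟩

/-- **Faithfulness: for `θ ≥ 2π` the arc sites are the tree's `lswSites`** (first exit of a
witnessing open path from the disc `‖·‖ ≤ R`; every direction is an arc direction).
[cite: LawlerSchrammWernerEJP2002, §2 (p. 3)] -/
theorem lswArcSites_eq_lswSites {R θ : ℝ} (hθ : 2 * Real.pi ≤ θ) (ω : SiteConfig (Site 2)) :
    lswArcSites R θ ω = lswSites R ω := by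
  refine Subset.antisymm (lswArcSites_subset_lswSites R θ ω) ?_
  rintro x ⟨hx, y, hy, hp⟩
  obtain ⟨a, b, -, hb, hbω, hab, hpa⟩ :=
    hp.exit (R := {v : Site 2 | ‖triEmbed v‖ ≤ R}) (show ‖triEmbed x‖ ≤ R from hx.le)
      (show ¬ (‖triEmbed y‖ ≤ R) from not_le.2 hy)
  exact ⟨hx, a, b, hpa, hab, hbω, not_le.1 hb, inBottomArcDir_of_two_pi_le hθ _⟩

/-- `lswArcSites R θ ω` lies in the box of size `⌈2R⌉`. [folklore] -/
theorem lswArcSites_subset_box (R θ : ℝ) (ω : SiteConfig (Site 2)) :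
    lswArcSites R θ ω ⊆ ↑(box 2 ⌈2 * R⌉₊) :=
  (lswArcSites_subset_lswSites R θ ω).trans (lswSites_subset_box R ω)

/-- `lswArcSites R θ ω` is finite. [folklore] -/
theorem finite_lswArcSites (R θ : ℝ) (ω : SiteConfig (Site 2)) : (lswArcSites R θ ω).Finite :=
  (finite_lswSites R ω).subset (lswArcSites_subset_lswSites R θ ω)

/-- **Locality of `Q_δ(θ)`**: `lswArcSites R θ` only depends on the sites of norm at most `R + 1`
(the witnessing path stays in the disc and the outer endpoint of the exit edge has norm
`≤ R + 1`). [folklore] -/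
theorem lswArcSites_inter_eq {R θ : ℝ} (ω : SiteConfig (Site 2)) {T : Set (Site 2)}
    (hT : {v : Site 2 | ‖triEmbed v‖ ≤ R + 1} ⊆ T) : lswArcSites R θ (ω ∩ T) = lswArcSites R θ ω := by
  ext x
  constructor
  · rintro ⟨hx, a, b, hp, hab, hb, hRb, hdir⟩
    exact ⟨hx, a, b, hp.mono (inter_subset_inter_right _ inter_subset_left), hab, hb.1, hRb, hdir⟩
  · rintro ⟨hx, a, b, hp, hab, hb, hRb, hdir⟩
    have ha : ‖triEmbed a‖ ≤ R := hp.right_mem.1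
    have hbT : b ∈ T := hT (show ‖triEmbed b‖ ≤ R + 1 by linarith [norm_triEmbed_le_of_adj hab])
    refine ⟨hx, a, b, hp.mono fun v hv ↦ ⟨hv.1, hv.2, hT ?_⟩, hab, ⟨hb, hbT⟩, hRb, hdir⟩
    show ‖triEmbed v‖ ≤ R + 1
    linarith [show ‖triEmbed v‖ ≤ R from hv.1]

/-- Configurations agreeing on the sites of norm at most `R + 1` have the same `lswArcSites R θ`.
[folklore] -/
theorem lswArcSites_congr {R θ : ℝ} {ω ω' : SiteConfig (Site 2)} {T : Set (Site 2)}
    (hT : {v : Site 2 | ‖triEmbed v‖ ≤ R + 1} ⊆ T) (h : ω ∩ T = ω' ∩ T) :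
    lswArcSites R θ ω = lswArcSites R θ ω' := by
  rw [← lswArcSites_inter_eq ω hT, h, lswArcSites_inter_eq ω' hT]

/-- The rescaled set `Q_δ(θ) = A_θ^↓ ∪ δ · lswArcSites`, `δ = 1/R` (LSW 2002, §2, p. 3: "the union of
`A_θ` with all the connected components … which meet `A_θ`"). [cite: LawlerSchrammWernerEJP2002, §2 (p. 3)] -/
def lswArcSet (R θ : ℝ) (ω : SiteConfig (Site 2)) : Set ℂ :=
  bottomArc θ ∪ triMeshPoint R⁻¹ '' lswArcSites R θ ω

/-- `Q_δ(θ)` is compact (an arc and finitely many points). [folklore] -/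
theorem isCompact_lswArcSet (R θ : ℝ) (ω : SiteConfig (Site 2)) : IsCompact (lswArcSet R θ ω) :=
  (isCompact_bottomArc θ).union ((finite_lswArcSites R θ ω).image _).isCompact

/-- `-i ∈ A_θ^↓ ⊆ Q_δ(θ)`. [folklore] -/
theorem neg_I_mem_lswArcSet (R θ : ℝ) (ω : SiteConfig (Site 2)) : -I ∈ lswArcSet R θ ω :=
  Or.inl (neg_I_mem_bottomArc θ)

/-- **`Q_δ(θ) ⊆ Q_δ(2π)`** (the arc lies on the circle, arc sites are sites).
[cite: LawlerSchrammWernerEJP2002, §2 (p. 6: Q' = Q(2π) ∖ Q(θ))] -/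
theorem lswArcSet_subset_lswSet (R θ : ℝ) (ω : SiteConfig (Site 2)) : lswArcSet R θ ω ⊆ lswSet R ω :=
  union_subset_union (bottomArc_subset_sphere θ) (image_mono (lswArcSites_subset_lswSites R θ ω))

/-- `Q_δ(θ)` increases with `θ`. [folklore] -/
theorem lswArcSet_mono {R θ θ' : ℝ} (h : θ ≤ θ') (ω : SiteConfig (Site 2)) :
    lswArcSet R θ ω ⊆ lswArcSet R θ' ω :=
  union_subset_union (bottomArc_mono h) (image_mono (lswArcSites_mono h ω))

/-- **Faithfulness: `Q_δ(θ) = Q_δ(2π)` of the tree for `θ ≥ 2π`.** [cite: LawlerSchrammWernerEJP2002, §2 (p. 3)] -/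
theorem lswArcSet_eq_lswSet {R θ : ℝ} (hθ : 2 * Real.pi ≤ θ) (ω : SiteConfig (Site 2)) :
    lswArcSet R θ ω = lswSet R ω := by
  rw [lswArcSet, lswSet, bottomArc_eq_sphere hθ, lswArcSites_eq_lswSites hθ]

/-- `Q_δ(θ) ⊆ Ū`. [cite: LawlerSchrammWernerEJP2002, §2 (p. 3)] -/
theorem lswArcSet_subset_closedBall (R θ : ℝ) (ω : SiteConfig (Site 2)) :
    lswArcSet R θ ω ⊆ closedBall (0 : ℂ) 1 :=
  (lswArcSet_subset_lswSet R θ ω).trans (lswSet_subset_closedBall R ω)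

/-- **`Q_δ(θ)` as a point of the Hausdorff space** of non-empty compact subsets of `ℂ`
(LSW 2002, §2, p. 3: "The law of `Q_δ(θ)` can be thought of as a probability measure on the Hausdorff
space of compact subsets of `Ū`"). [cite: LawlerSchrammWernerEJP2002, §2 (p. 3)] -/
def lswArcCompact (R θ : ℝ) (ω : SiteConfig (Site 2)) : NonemptyCompacts ℂ :=
  ⟨⟨lswArcSet R θ ω, isCompact_lswArcSet R θ ω⟩, ⟨-I, neg_I_mem_lswArcSet R θ ω⟩⟩

/-- The underlying set of `lswArcCompact`. [folklore] -/
@[simp] theorem coe_lswArcCompact (R θ : ℝ) (ω : SiteConfig (Site 2)) :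
    (lswArcCompact R θ ω : Set ℂ) = lswArcSet R θ ω := rfl

/-- Configurations agreeing on the sites of norm at most `R + 1` have the same `Q_δ(θ)`. [folklore] -/
theorem lswArcCompact_congr {R θ : ℝ} {ω ω' : SiteConfig (Site 2)} {T : Set (Site 2)}
    (hT : {v : Site 2 | ‖triEmbed v‖ ≤ R + 1} ⊆ T) (h : ω ∩ T = ω' ∩ T) :
    lswArcCompact R θ ω = lswArcCompact R θ ω' :=
  NonemptyCompacts.ext (by simp only [coe_lswArcCompact, lswArcSet, lswArcSites_congr hT h])

/-- **`Q_δ(θ)` is a random compact set**: `lswArcCompact R θ` is measurable (every preimage is a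
cylinder event over the box of size `⌈2(R+1)⌉`). [folklore] -/
theorem measurable_lswArcCompact (R θ : ℝ) : Measurable (lswArcCompact R θ) := by
  intro t _
  have hT : {v : Site 2 | ‖triEmbed v‖ ≤ R + 1} ⊆ (↑(box 2 ⌈2 * (R + 1)⌉₊) : Set (Site 2)) :=
    subset_box_of_norm_le fun _ hv => hv
  refine DeterminedBy.measurableSet_of_finset (F := box 2 ⌈2 * (R + 1)⌉₊) ?_
  rw [determinedBy_iff]
  intro ω ω' h
  simp only [Set.mem_preimage]
  rw [lswArcCompact_congr hT h]

/-- `Q_δ(θ) ∈ subUnitDisc`. [folklore] -/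
theorem lswArcCompact_mem_subUnitDisc (R θ : ℝ) (ω : SiteConfig (Site 2)) :
    lswArcCompact R θ ω ∈ subUnitDisc :=
  lswArcSet_subset_closedBall R θ ω

/-- `Q_δ(θ) = Q_δ(2π)` of the tree as points of the Hausdorff space, for `θ ≥ 2π`.
[cite: LawlerSchrammWernerEJP2002, §2 (p. 3)] -/
theorem lswArcCompact_eq_lswCompact {R θ : ℝ} (hθ : 2 * Real.pi ≤ θ) (ω : SiteConfig (Site 2)) :
    lswArcCompact R θ ω = lswCompact R ω :=
  NonemptyCompacts.ext (by rw [coe_lswArcCompact, coe_lswCompact, lswArcSet_eq_lswSet hθ])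

/-! ### The pairs `(Q_δ(θ), Q_δ(2π))` and their laws -/

/-- The pair `(Q_δ(θ), Q_δ(2π))` of the arc hull and the full hull in the same configuration
(LSW 2002, §2, p. 6: `Q' := Q(2π) ∖ Q(θ)`). [cite: LawlerSchrammWernerEJP2002, §2 (p. 6)] -/
def lswArcPair (R θ : ℝ) (ω : SiteConfig (Site 2)) : NonemptyCompacts ℂ × NonemptyCompacts ℂ :=
  (lswArcCompact R θ ω, lswCompact R ω)

/-- The components of `lswArcPair`. [folklore] -/
@[simp] theorem lswArcPair_fst (R θ : ℝ) (ω : SiteConfig (Site 2)) : (lswArcPair R θ ω).1 = lswArcCompact R θ ω := rfl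

/-- The components of `lswArcPair`. [folklore] -/
@[simp] theorem lswArcPair_snd (R θ : ℝ) (ω : SiteConfig (Site 2)) : (lswArcPair R θ ω).2 = lswCompact R ω := rfl

/-- The pair map is measurable. [folklore] -/
theorem measurable_lswArcPair (R θ : ℝ) : Measurable (lswArcPair R θ) :=
  (measurable_lswArcCompact R θ).prodMk (measurable_lswCompact R)

/-- In every configuration `Q_δ(θ) ⊆ Q_δ(2π)`. [cite: LawlerSchrammWernerEJP2002, §2 (p. 6)] -/
theorem lswArcPair_fst_subset_snd (R θ : ℝ) (ω : SiteConfig (Site 2)) :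
    (((lswArcPair R θ ω).1 : NonemptyCompacts ℂ) : Set ℂ) ⊆ ((lswArcPair R θ ω).2 : Set ℂ) :=
  lswArcSet_subset_lswSet R θ ω

/-- **The joint law of `(Q_δ(θ), Q_δ(2π))`**, `δ = 1/R`, a Borel probability measure on
`NonemptyCompacts ℂ × NonemptyCompacts ℂ`. [cite: LawlerSchrammWernerEJP2002, §2 (p. 3, p. 6)] -/
def lswPairLaw (R θ : ℝ) : ProbabilityMeasure (NonemptyCompacts ℂ × NonemptyCompacts ℂ) :=
  triSiteLawHalf.map (measurable_lswArcPair R θ).aemeasurable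

/-- The joint law evaluated on a Borel set. [folklore] -/
theorem lswPairLaw_apply (R θ : ℝ) {A : Set (NonemptyCompacts ℂ × NonemptyCompacts ℂ)} (hA : MeasurableSet A) :
    (lswPairLaw R θ : Measure (NonemptyCompacts ℂ × NonemptyCompacts ℂ)) A =
      triSitePercolation half (lswArcPair R θ ⁻¹' A) := by
  rw [lswPairLaw, ProbabilityMeasure.map_apply' _ _ hA, coe_triSiteLawHalf]

/-- The joint law as a push-forward measure. [folklore] -/
theorem coe_lswPairLaw (R θ : ℝ) :
    (lswPairLaw R θ : Measure (NonemptyCompacts ℂ × NonemptyCompacts ℂ)) =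
      (triSitePercolation half).map (lswArcPair R θ) := by
  ext A hA
  rw [lswPairLaw_apply R θ hA, Measure.map_apply (measurable_lswArcPair R θ) hA]

/-- **The second marginal of the joint law is the law of `Q_δ(2π)`**: `(lswPairLaw R θ) ∘ snd⁻¹ = lswLaw R`.
[cite: LawlerSchrammWernerEJP2002, §2 (p. 3)] -/
theorem map_snd_lswPairLaw (R θ : ℝ) :
    (lswPairLaw R θ : Measure (NonemptyCompacts ℂ × NonemptyCompacts ℂ)).map Prod.snd =
      (lswLaw R : Measure (NonemptyCompacts ℂ)) := by
  rw [coe_lswPairLaw, Measure.map_map measurable_snd (measurable_lswArcPair R θ)]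
  ext A hA
  rw [Measure.map_apply ((measurable_snd).comp (measurable_lswArcPair R θ)) hA, lswLaw_apply R hA]
  rfl

/-- **`Q_δ(θ) ⊆ Q_δ(2π)` almost surely** under the joint law (indeed surely).
[cite: LawlerSchrammWernerEJP2002, §2 (p. 6)] -/
theorem ae_fst_subset_snd_lswPairLaw (R θ : ℝ) :
    ∀ᵐ p ∂(lswPairLaw R θ : Measure (NonemptyCompacts ℂ × NonemptyCompacts ℂ)),
      ((p.1 : NonemptyCompacts ℂ) : Set ℂ) ⊆ (p.2 : Set ℂ) := by
  rw [coe_lswPairLaw]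
  refine (ae_map_iff (measurable_lswArcPair R θ).aemeasurable ?_).2 (ae_of_all _ fun ω ↦ lswArcPair_fst_subset_snd R θ ω)
  exact isClosed_setOf_fst_subset_snd.measurableSet

/-- The joint laws are carried by the pairs of subsets of the closed unit disc (the hypothesis of
`exists_tendsto_subseq_pairLaw`). [folklore] -/
theorem lswPairLaw_compl_prod_subUnitDisc (R θ : ℝ) :
    (lswPairLaw R θ : Measure (NonemptyCompacts ℂ × NonemptyCompacts ℂ)) (subUnitDisc ×ˢ subUnitDisc)ᶜ = 0 := by
  rw [lswPairLaw_apply R θ (isClosed_subUnitDisc.prod isClosed_subUnitDisc).measurableSet.compl]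
  have : lswArcPair R θ ⁻¹' (subUnitDisc ×ˢ subUnitDisc)ᶜ = ∅ :=
    eq_empty_of_forall_notMem fun ω hω =>
      hω ⟨lswArcCompact_mem_subUnitDisc R θ ω, lswCompact_mem_subUnitDisc R ω⟩
  rw [this, measure_empty]

end Literature.Probability.Percolation
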